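import Summits.Langlands.Langlands.Theses.AbelianSurfaceSerre
import HarnessLib

/-!
# Crux `AbelianSurfaceSerre.QuadraticImprimitiveSurfaces` (stmt-Langlands-17766) — proof skeleton of
# line `Sketch` (card `switch-patch-wreath`): Serre for `GSp₄` at WREATH residues (similitude FIXED)
# ⟹ the crux

Cycle-3 RESHAPE v4 (continuation lead c2, 2026-08-17): the two stubs of v3 were PROMOTED to route
items on the lead's promote-stub request (route rev 4, route-choice Th-5a483c54): `SerreGSp4WreathFixed`
(stmt-Langlands-18072, verbatim the v3 stub `stub_serreGSp4WreathFixed`) and `WreathReductionFixed`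
(stmt-Langlands-18078, verbatim `stub_wreathReductionFixed`, ≡ the named fact by `Iff.rfl`).  v4 states
both stubs BY NAME of those route decls (bodies unchanged, definitionally), so the composition is
literally "K2 ⇐ 18072 + 18078 by modus ponens"; the in-tree bridge is
`Theorems/AbelianSurfaceSerreQuadraticImprimitiveSurfacesOfWreathItems.lean`.

Cycle-2 RESHAPE v3 (continuation lead c1, 2026-08-17), after the wave-1 finding that the accepted
named fact `bcgp_serreWreath_implies_quadraticImprimitiveSurfacesModular` (= the cycle-1 stub
`stub_wreathReduction`) OVER-CLAIMS against the source: its Serre bracket lets the automorphic lift be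
symplectic for SOME multiplier `μ`, while BCGP 2025 Lemma 10.4.1 / Prop. 7.5.7 fix the central
character `|·|²` (`ν ∘ ρ_{π,p} = ε⁻¹`), and an induced (wreath) residue carries TWO similitude
classes `ε̄⁻¹`, `ε̄⁻¹χ_K` — a lift of the second class cannot be fed to the printed proof (provefact
audit, accepted tree file `Literature/NumberTheory/DiophantineGeometry/BcgpSerreWreathFixedSimilitudeImprimitiveSurfaces.lean`,
whose theorem `…FixedSimilitude…_of_serreWreath` states the corrected implication as its conclusion
type and proves it from the old fact).  The line now runs through the CORRECTED reduction:

* `stub_serreGSp4WreathFixed` — the OPEN input: Serre's conjecture for `GSp₄/ℚ` in regular ordinary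
  weight (`GL₄` proxy, `p ≥ P₀`) at the wreath residues, with the similitude of the lift PINNED to
  `ε_p^{-(1+2s)}`, `p - 1 ∣ s` (verbatim the antecedent of the corrected implication).  NOT implied
  by `RegularSerreAbelianSurfaces.OrdinarySerreGSp4` (stmt-Langlands-17569) as typed (its conclusion
  has the free `∃ μ`); the audit asks the planner to pin 17569 the same way.
* `stub_wreathReductionFixed` — the corrected printed reduction "(that) ⟹ crux" = [proof of
  Lemma 10.4.1, type **B**[C₂], Rem. 10.4.2] ∘ [descent `GL₄ → GSp₄` + twist `ε^{s}`] +
  [Thm. 10.2.1] + [Faltings]; vended by this line as the named fact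
  `bcgp_serreWreathFixedSimilitude_implies_quadraticImprimitiveSurfacesModular` (inline def in the
  `--supports` file `Theorems/AbelianSurfaceSerreQuadraticImprimitiveSurfacesWreathReductionFixed.lean`,
  relocated by the gate); unproved in the tree (XL).

`QuadraticImprimitiveSurfaces_of := stub_wreathReductionFixed stub_serreGSp4WreathFixed` concludes
the crux BY NAME.  Imports: the Theses file only.  History: cycle 1 registered
`stub_ordinarySerreGSp4` (= 17569 verbatim) + `stub_wreathReduction` (= old fact); cycle 2 v2
weakened the first to the old wreath restriction; v3 (this file) pins the similitude in both.
-/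

set_option linter.dupNamespace false

namespace Summit.Langlands.Langlands.Cruxes.QuadraticImprimitiveSurfaces.Sketch

/-- **Stub (open input): Serre's conjecture for `GSp₄/ℚ` in regular ordinary weight at the WREATH
residues, `GL₄` proxy, `p ≥ P₀`, similitude of the lift FIXED.**  For `p ≥ P₀` and
`ρ̄ : Γ_ℚ → GL₄(k)` (`k` algebraically closed of characteristic `p`, discrete) irreducible, symplectic
with multiplier `ε̄_p⁻¹`, upper-triangularisable at `p` with pairwise distinct diagonal characters,
with image of order `2p²(p-1)(p²-1)² = |Δ_p ⋊ C₂|`, irreducible on `Γ_{ℚ(ζ_p)}` and reducible on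
`Γ_K` for some quadratic `K`: there are a regular algebraic cuspidal `π` on `GL₄(𝔸_ℚ)` unramified at
`p` and a framed `r : Γ_ℚ → GL₄(ℚ̄_p)` symplectic with multiplier EXACTLY `ε_p^{-(1+2s)}` for some
`s` with `p - 1 ∣ s`, Greenberg-ordinary of injective shape at `p`, Satake–Frobenius compatible with
`π` a.e. (HLTT `m = 4`), whose integral Frobenius polynomials reduce to those of `ρ̄` a.e.  (BCGP
2025 Lemma 10.4.1 hypothesis, Rem. 10.4.2 variant, central character `|·|²`, restricted to the
residues its proof p. 146 uses for type **B**[C₂]; in nature `r = ρ_{π,p} ⊗ ε^{-s}`.)  OPEN.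
= route item `SerreGSp4WreathFixed` (stmt-Langlands-18072), stated BY NAME (v4).
[cite: BoxerCalegariGeePilloni2025, Lemma 10.4.1, Rem. 10.4.2, proof p. 146; §1 (central character |·|²); Prop. 7.5.7] -/
theorem stub_serreGSp4WreathFixed :
    Summit.Langlands.Langlands.Theses.AbelianSurfaceSerre.SerreGSp4WreathFixed := by
  sorry

/-- **Stub (corrected printed reduction): Serre at the wreath residues with fixed similitude ⟹ the
crux.**  BCGP 2025, proof of Lemma 10.4.1 (p. 146, Galois type **B**[C₂]: density-one good primes
`p` split in `E`, image `Δ_p ⋊ C₂`, then "`ρ` is modular from multiplicity one and classicity",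
Thm. 7.5.8 with Prop. 7.5.7 — a fixed-similitude `ε⁻¹` deformation problem, whence the pinned
multiplier and the twist `ε^{s}`, `p - 1 ∣ s`) + descent `GL₄ → GSp₄` (Prop. 7.5.3 (1), Arthur 2013
Thm 1.5.2, Gee–Taïbi 2019 §2) + Theorem 10.2.1 (every Galois type other than **A**, **B**[C₂] is
modular unconditionally) + Faltings (`End_ℚ(A) = ℤ` and `r|Γ_K` reducible exclude type **A**).
Verbatim the conclusion type of the accepted audit theorem
`Literature.NumberTheory.DiophantineGeometry.bcgp_serreWreathFixedSimilitude_implies_quadraticImprimitiveSurfacesModular_of_serreWreath`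
and the named fact `bcgp_serreWreathFixedSimilitude_implies_quadraticImprimitiveSurfacesModular`
(vended by this line); its consequent is the body of the crux.
= route item `WreathReductionFixed` (stmt-Langlands-18078), stated BY NAME (v4).
[cite: BoxerCalegariGeePilloni2025, Lemma 10.4.1 proof p. 146 (type B[C₂]), Rem. 10.4.2; Prop. 7.5.3 (1); Prop. 7.5.7; Thm. 7.5.8; Thm 10.2.1; Rem. 10.2.2]
[cite: Faltings1983Endlichkeit, Satz 3–4] -/
theorem stub_wreathReductionFixed :
    Summit.Langlands.Langlands.Theses.AbelianSurfaceSerre.WreathReductionFixed := by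
  sorry

/-- **Composition: the crux by name, modulo the stubs** — literally `K2 ⇐ 18072 + 18078` by modus
ponens (`WreathReductionFixed` unfolds to `SerreGSp4WreathFixed → QuadraticImprimitiveSurfaces`). -/
theorem QuadraticImprimitiveSurfaces_of :
    Summit.Langlands.Langlands.Theses.AbelianSurfaceSerre.QuadraticImprimitiveSurfaces :=
  stub_wreathReductionFixed stub_serreGSp4WreathFixed

/-! ## Record (not stubs) — state after cycles 2–3

* Corrected named fact LANDED (p153517):
  `Literature.NumberTheory.DiophantineGeometry.bcgp_serreWreathFixedSimilitude_implies_quadraticImprimitiveSurfacesModular`;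
  calibration `wreathReductionFixed_iff_fact : (stub_wreathReductionFixed's statement) ↔ fact := Iff.rfl`,
  `serreGSp4Wreath_of_serreGSp4WreathFixed` (pinned ⟹ `∃ μ`) and the one-theorem conditional closure
  `QuadraticImprimitiveSurfaces_of_wreathFixedFact (hX : fact) (hSerre : pinned wreath Serre)` are in
  `Theorems/AbelianSurfaceSerreQuadraticImprimitiveSurfacesWreathReductionFixed.lean` (p154717).
* Clifford index two LANDED: `Theorems/…CliffordIndexTwo.lean` (p154177, abstract: `V = U ⊕ π(g)U`,
  `dim V = 2 dim U`, `U` irreducible) and `Theorems/…CliffordInduced.lean` (p154552, framed/Galois: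
  quadratically-imprimitive irreducible `r : Γ_ℚ → GL₄(A)` has the charpolys of `Ind_{Γ_K}^{Γ_ℚ} s`,
  `s : Γ_K → GL₂(A)` irreducible — the cards' `ImprimitiveIsInduced` with `r` irreducible as
  hypothesis; first step of every GL₂/K line).
* The cycle-1/2 stubs `stub_wreathReduction` (= old fact, over-claiming `∃ μ` bracket) and
  `stub_serreGSp4Wreath` / `stub_ordinarySerreGSp4` are RETIRED; the landed
  `stub_serreWreath_of_ordinarySerre` (p147925) and `QuadraticImprimitiveSurfaces_of_wreathFact`
  (p149483) remain true records of the `∃ μ` reading (17569 ⟹ old wreath stub ⟹ crux via old fact).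
  `OrdinarySerreGSp4` (stmt-Langlands-17569) as typed does NOT imply `stub_serreGSp4WreathFixed`.
* Cycle 3 (continuation lead c2): stubs UNCHANGED (both unprovable by nature: open conjecture / unproved
  XL fact); Clifford–Mackey non-conjugacy LANDED: `Theorems/…CliffordMackey.lean` (p157104, abstract:
  `Hom_N(U, Res V) = k·ι`, `Hom_N(U, π(g)U) = 0`, `U ≇ π(g)U` over any algebraically closed field) and
  `Theorems/…CliffordMackeyInduced.lean` (framed/Galois/rank 4: `r ∼ Ind s`, `s` irreducible with
  `s ≇ s^σ` — no non-zero intertwiner with its conjugate, either direction); outcome `promote-stub: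
  stub_serreGSp4WreathFixed` (file it as a @[conjecture] item or pin+widen K1; then the crux is closed
  conditionally by `QuadraticImprimitiveSurfaces_of_wreathFixedFact`, p154717, modulo the fact).
-/

end Summit.Langlands.Langlands.Cruxes.QuadraticImprimitiveSurfaces.Sketch
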